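import Summits.ResolutionOfSingularities.ResolutionOfSingularities.Theorems.FrobeniusClosingSteerArithReductionLegality
import HarnessLib

/-!
# Crux `Steer` (stmt-ResolutionOfSingularities-16345), chain W4.1, hH2′ trichotomy — the ONE-AXIS legality slot (H3):
# «a late UNIAXIAL on-axis A-stage forces a positive step of height ≥ 2 at the next visit» (`H3_oneAxis_of_pieces`)

OURS (campaign `res-hironaka`, rung L ★L-G4, slot W4.1; statements about the route's own objects — a σ_top-steered run
`Words.IsSteeredRun O R P t 2 s`, its visit pairs, the one-step law between visits, and the UNIAXIAL datum `s i² − g² − c·m^d ∈ 𝔪^(d+1)`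
of res-L0-w41-strat-2's hH2′ residue word (`NRA/NonRationalAWindow_words_v3.lean` 9caa8decdca80901, `H3OneAxisTwoN` l.238, res-L0-w41-tri-1
TRIAGE v6.48 (B) / v6.52 PASS); seat res-D-pv-036 g11 on res-L0-w41-plan-1 RULING 288 (b)(2) «W-NRA-U PROOF = pv-036», custody res-plan-2
RECORD #72 (1). They replace the role of no printed item and are NOT statements of the manuscript under review [claim: Hironaka2017,
status: under-review]; AI review is weaker than expert review). Theses-free, definition-free; the binary sibling is
`…ArithReductionLegality` (`exists_posStepTwo_of_residue_zero`, `H3_of_pieces`, res-type-062), whose argument is re-run here with ONE axis.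

## What is proved

* §1 `div_pow_mem_oneAxis` — division of the uniaxial congruence by `u^d` in the transform: `F/u^d ∈ R′`, `m/u ∈ R′` and
  `F/u^d − c·(m/u)^d ∈ u·R′` (the binary `OddBranchParity.div_pow_mem_and_sub_eval_mem` at the form `Ψ := c·X₀^d`).
* §1 `exists_isPermissibleCentre_oneAxis` — the one-axis twin of res-D-pv-003's BRICK #2 `OddBranchParity.exists_isPermissibleCentre_of_residue_zero`:
  at the transform `R′` of a point step with exceptional parameter `u`, a uniaxial datum `F ≡ c·m^d (mod 𝔪^(d+1))` (`m ∈ 𝔪 ∖ 𝔪²`, `d ≥ 1`) ON THE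
  AXIS (`v m < v u`) and a post-strip radicand `f = h² + u·c′·(F/u^d)` with no singular prime of height `≤ 1` give the σ_top-PERMISSIBLE CENTRE
  `Q := (u, m/u)` (height 2, regular quotient: `(u, m/u)` is part of a regular system of parameters by `OddBranchParity.isRsopPart_excParam_strictTransform`;
  `F/u^d ∈ (u, m/u)` since `c·(m/u)^d ∈ (m/u)` and the remainder lies in `uR′`; then `OddBranchParity.isPermissibleCentre_of_linearFactor`).
* §2 `exists_posStepTwo_oneAxis` — the H3 core on one axis (the law algebra of `ArithReductionLegality.exists_posStepTwo_of_residue_zero` verbatim,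
  §1 in place of the residue-zero brick, σ_top maximality `SigmaTopMaximality.isPosStep_and_two_le_height_of_exists_isPermissibleCentre'`).
* §3 **`H3_oneAxis_of_pieces`** — the slot from the pieces (point steps recur, S1a law at late visits, members regular of dimension `n ≥ 3`, N4 beyond
  `N`): its statement is the body of strat-2's `H3OneAxisTwoN` after the leading universal binders, so that
  `(fun K _ _ O R P t s => H3_oneAxis_of_pieces) : H3OneAxisTwoN` once the words file lands.

[cite: NovacoskiSpivakovsky2014, Def. 2.11] [cite: Matsumura1987, Thm. 14.2] [folklore]
-/

noncomputable section

-- `Summit.<S>.<S>.…` duplicates the summit name by design (single-problem summit).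
set_option linter.dupNamespace false

open IsLocalRing MvPolynomial
open Literature.AlgebraicGeometry.Resolution (IsLocalBlowupAlong SubringDominates IsRsopPart locAtCentre
  subringDominates_locAtCentre)

namespace Summit.ResolutionOfSingularities.ResolutionOfSingularities.Theorems.SwitchingDichotomy

namespace ArithReductionLegality

open Summit.ResolutionOfSingularities.ResolutionOfSingularities.Theorems.SwitchingDichotomy.SigmaTopLegality (IsPointStep IsPosStep)
open Summit.ResolutionOfSingularities.ResolutionOfSingularities.Theorems.SwitchingDichotomy.Words
  (IsSteeredRun HasCleanedOrderAt IsAStageAt IsVisitPair)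

variable {K : Type} [Field K]

/-! ## §1 The one-axis centre `(u, m/u)` -/

section Centre

variable {O : ValuationSubring K} {S : Subring K}

/-- **Division of the uniaxial congruence by `u^d`.** At the transform `R` of the point step `S` with exceptional parameter `u`, for
`m ∈ 𝔪_S` and `F ≡ c·m^d (mod 𝔪_S^(d+1))`: `F/u^d ∈ R`, `m/u ∈ R`, and `F/u^d − c·(m/u)^d ∈ u·R` (the binary division lemma at the
form `c·X₀^d`, second variable idle). [cite: NovacoskiSpivakovsky2014, Def. 2.11] [folklore] -/
theorem div_pow_mem_oneAxis [IsLocalRing S] {R : Subring K} (hbl : IsLocalBlowupAlong O S (maximalIdeal S) R) {u : K}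
    (huS : u ∈ S) (hum : (⟨u, huS⟩ : S) ∈ maximalIdeal S) (hu0 : u ≠ 0)
    (humax : ∀ y : S, y ∈ maximalIdeal S → O.valuation (y : K) ≤ O.valuation u)
    {d : ℕ} (c : S) {m : S} (hm : m ∈ maximalIdeal S) {F : S} (hF : F - c * m ^ d ∈ maximalIdeal S ^ (d + 1)) :
    ∃ (hG : (F : K) / u ^ d ∈ R) (hmu : (m : K) / u ∈ R),
      (⟨(F : K) / u ^ d, hG⟩ : R) - Subring.inclusion hbl.isLocalBlowup.le c * ⟨(m : K) / u, hmu⟩ ^ d ∈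
        Ideal.span {(⟨u, hbl.isLocalBlowup.le huS⟩ : R)} := by
  set Ψ : MvPolynomial (Fin 2) S := C c * X 0 ^ d with hΨdef
  have hΨ : Ψ.IsHomogeneous d := by
    have h := (isHomogeneous_C (Fin 2) c).mul (isHomogeneous_X_pow (R := S) (0 : Fin 2) d)
    rwa [zero_add] at h
  have hev : eval ![m, m] Ψ = c * m ^ d := by
    simp [hΨdef]
  have hF' : F - eval ![m, m] Ψ ∈ maximalIdeal S ^ (d + 1) := by rw [hev]; exact hF
  obtain ⟨hG, h₁, h₂, hdiff⟩ := OddBranchParity.div_pow_mem_and_sub_eval_mem hbl huS hum hu0 humax Ψ hΨ hm hm hF'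
  refine ⟨hG, h₁, ?_⟩
  have hevR : eval ![(⟨(m : K) / u, h₁⟩ : R), ⟨(m : K) / u, h₂⟩] (map (Subring.inclusion hbl.isLocalBlowup.le) Ψ) =
      Subring.inclusion hbl.isLocalBlowup.le c * ⟨(m : K) / u, h₁⟩ ^ d := by
    simp [hΨdef, map_C, map_X]
  rw [hevR] at hdiff
  exact hdiff

variable [CharP K 2] [IsRegularLocalRing S]

/-- **The one-axis permissible centre** (twin of res-D-pv-003's `OddBranchParity.exists_isPermissibleCentre_of_residue_zero`). DATA: a point
step `S → R` of the run along `O` (`S` regular local dominated by `O`, `R` regular local), an exceptional parameter `u`; at `S` a UNIAXIAL datum: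
`m ∈ 𝔪_S ∖ 𝔪_S²` ON THE AXIS (`v m < v u`), `d ≥ 1`, `F ≡ c·m^d (mod 𝔪_S^(d+1))`; at `R` the post-strip radicand `f = h² + u·c′·G` with
`G = F/u^d`, no singular prime of height `0` or `1`, `dim R = n ≥ 3`. CONCLUSION: a σ_top-PERMISSIBLE CENTRE exists at `R`, namely `(u, m/u)`.
[cite: Matsumura1987, Thm. 14.2] [cite: NovacoskiSpivakovsky2014, Def. 2.11] [folklore] -/
theorem exists_isPermissibleCentre_oneAxis (hdom : SubringDominates S O.toSubring) {R : Subring K}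
    (hbl : IsLocalBlowupAlong O S (maximalIdeal S) R) [IsRegularLocalRing R] {u : K} (huS : u ∈ S)
    (hum : (⟨u, huS⟩ : S) ∈ maximalIdeal S) (hu0 : u ≠ 0)
    (humax : ∀ y : S, y ∈ maximalIdeal S → O.valuation (y : K) ≤ O.valuation u)
    {m : S} (hm : m ∈ maximalIdeal S) (hm2 : m ∉ maximalIdeal S ^ 2) (hmu : O.valuation (m : K) < O.valuation u)
    {d : ℕ} (hd : 1 ≤ d) (c : S) {F : S} (hF : F - c * m ^ d ∈ maximalIdeal S ^ (d + 1))
    (f h c' G : R) (hGval : (G : K) = (F : K) / u ^ d)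
    (hf : f = h ^ 2 + ⟨u, hbl.isLocalBlowup.le huS⟩ * (c' * G))
    (h0 : ∀ (Q : Ideal R) [Q.IsPrime], Q.height = 0 → ¬ SigmaTopLegality.IsSingPrime R 2 f Q)
    (h1 : ∀ (Q : Ideal R) [Q.IsPrime], Q.height = 1 → ¬ SigmaTopLegality.IsSingPrime R 2 f Q)
    {n : ℕ} (hn : 3 ≤ n) (hdim : ringKrullDim R = n) :
    ∃ Q : Ideal R, SigmaTopLegality.IsPermissibleCentre R 2 f Q := by
  have hle : S ≤ R := hbl.isLocalBlowup.le
  set uR : R := ⟨u, hle huS⟩ with huR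
  -- `(u, m/u)` is part of a regular system of parameters of `R`
  have hm2' : (⟨(m : K), m.2⟩ : S) ∉ maximalIdeal S ^ 2 := by
    have e : (⟨(m : K), m.2⟩ : S) = m := Subtype.ext rfl
    rw [e]; exact hm2
  obtain ⟨hu', hmu', hz2⟩ := OddBranchParity.isRsopPart_excParam_strictTransform hdom hbl huS hum hu0 humax m.2 hm2' hmu
  set mR : R := ⟨(m : K) / u, hmu'⟩ with hmR
  -- division: `G − c·(m/u)^d ∈ uR`
  obtain ⟨hG', hmu'', hdiff⟩ := div_pow_mem_oneAxis hbl huS hum hu0 humax c hm hF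
  have hGeq : G = ⟨(F : K) / u ^ d, hG'⟩ := Subtype.ext hGval
  have hmm : (⟨(m : K) / u, hmu''⟩ : R) = mR := Subtype.ext rfl
  rw [hmm] at hdiff
  -- `G ∈ (u, m/u)`
  have hGmem : G ∈ Ideal.span ({uR, mR} : Set R) := by
    have e : G = (G - Subring.inclusion hle c * mR ^ d) + Subring.inclusion hle c * mR ^ d := by ring
    rw [e, Ideal.span_insert]
    refine Ideal.add_mem _ (Ideal.mem_sup_left ?_) (Ideal.mem_sup_right ?_)
    · rw [hGeq]; exact hdiff
    · obtain ⟨k, rfl⟩ : ∃ k, d = k + 1 := ⟨d - 1, by omega⟩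
      rw [pow_succ, ← mul_assoc]
      exact Ideal.mul_mem_left _ _ (Ideal.mem_span_singleton_self mR)
  have hcG : c' * G ∈ Ideal.span ({uR, mR} : Set R) := Ideal.mul_mem_left _ _ hGmem
  exact ⟨_, OddBranchParity.isPermissibleCentre_of_linearFactor R f h uR mR (c' * G) hz2 hf hcG h0 h1 hn hdim⟩

end Centre

/-! ## §2 The one-axis H3 core -/

section Core

variable [CharP K 2] {O : ValuationSubring K} {R : ℕ → Subring K} {P : (i : ℕ) → Ideal (R i)} {t : K} {s : ℕ → K}

/-- **One-axis H3 core.** In a steered run at `p = 2` (`R 0` dominated by `O`), let `i < j′` be a VISIT PAIR with `R i`, `R j′` regular,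
`dim R j′ = n ≥ 3`; at `i` a UNIAXIAL datum of ODD degree `d`: `s i² − g² − c·m^d ∈ 𝔪^(d+1)` with `m ∈ 𝔪 ∖ 𝔪²` ON THE AXIS of the
exceptional parameter `u` (`v m < v u`); the members between the visits constant (`R j′ = R (i+1)`) and the unit-cofactor strict-transform law
`s j′ · u^(d/2) · W = s i − G′`; no singular prime of height `0`/`1` at `j′`. Then stage `j′` is a positive step of height `≥ 2` (centre
`(u, m/u)`). [cite: Matsumura1987, Thm. 14.2] [folklore] -/
theorem exists_posStepTwo_oneAxis (hrun : IsSteeredRun O R P t 2 s) (hR0 : SubringDominates (R 0) O.toSubring)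
    {i j' : ℕ} (hvisit : IsVisitPair R P i j') [hregi : IsRegularLocalRing (R i)] [hregj : IsRegularLocalRing (R j')]
    {n : ℕ} (hn : 3 ≤ n) (hdim : ringKrullDim (R j') = n)
    {d : ℕ} (hd : Odd d) (hs : s i ^ 2 ∈ R i) (g m c : R i)
    (hm𝔪 : m ∈ maximalIdeal (R i)) (hm2 : m ∉ maximalIdeal (R i) ^ 2)
    (hcong : (⟨s i ^ 2, hs⟩ : R i) - g ^ 2 - c * m ^ d ∈ maximalIdeal (R i) ^ (d + 1))
    {u : K} (hu : (∃ hu : u ∈ R i, (⟨u, hu⟩ : R i) ∈ P i) ∧ u ≠ 0 ∧ ∀ y : R i, y ∈ P i → O.valuation (y : K) ≤ O.valuation u)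
    (hmu : O.valuation (m : K) < O.valuation u)
    (hRj : R j' = R (i + 1)) {G' W : K} (hG'R : G' ∈ R j') (hWi : W⁻¹ ∈ R j') (hW0 : W ≠ 0)
    (hlawEq : s j' * u ^ (d / 2) * W = s i - G')
    (h0 : ∀ (hs' : s j' ^ 2 ∈ R j') (Q : Ideal (R j')) [Q.IsPrime], Q.height = 0 →
      ¬ SigmaTopLegality.IsSingPrime (R j') 2 ⟨s j' ^ 2, hs'⟩ Q)
    (h1 : ∀ (hs' : s j' ^ 2 ∈ R j') (Q : Ideal (R j')) [Q.IsPrime], Q.height = 1 →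
      ¬ SigmaTopLegality.IsSingPrime (R j') 2 ⟨s j' ^ 2, hs'⟩ Q) :
    IsPosStep R P j' ∧ 2 ≤ (P j').height := by
  obtain ⟨hij, hpti, hptj, -⟩ := id hvisit
  -- the point step at `i` and its blow-up clause
  have hbl : ∀ k, IsLocalBlowupAlong O (R k) (P k) (R (k + 1)) := fun k => by
    obtain ⟨_, _, -, h, -⟩ := hrun.2 k
    exact h
  have hdom : ∀ k, SubringDominates (R k) O.toSubring :=
    SigmaTopLegality.subringDominates_of_isLocalBlowup O R hR0 fun k => (hbl k).isLocalBlowup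
  obtain ⟨hloci, hPi⟩ := hpti
  have hbl𝔪 : IsLocalBlowupAlong O (R i) (maximalIdeal (R i)) (R (i + 1)) := by
    have h := hbl i
    rw [hPi] at h
    exact h
  -- the next member is the blow-up of the A-stage member (strips keep the ring)
  have hbl' : IsLocalBlowupAlong O (R i) (maximalIdeal (R i)) (R j') := hRj ▸ hbl𝔪
  have hle : R i ≤ R j' := hbl'.isLocalBlowup.le
  -- the exceptional parameter `u`
  obtain ⟨⟨huR, huP⟩, hu0, humax⟩ := hu
  have hum : (⟨u, huR⟩ : R i) ∈ maximalIdeal (R i) := by rw [← hPi]; exact huP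
  have humax' : ∀ y : R i, y ∈ maximalIdeal (R i) → O.valuation (y : K) ≤ O.valuation u := fun y hy =>
    humax y (hPi ▸ hy)
  -- `F := s² − g²`, `F − c·m^d ∈ 𝔪^(d+1)`, `F/u^d ∈ R j'`
  set F : R i := ⟨s i ^ 2, hs⟩ - g ^ 2 with hF
  have hFcong : F - c * m ^ d ∈ maximalIdeal (R i) ^ (d + 1) := hcong
  obtain ⟨hGmem, -, -⟩ := div_pow_mem_oneAxis hbl' huR hum hu0 humax' c hm𝔪 hFcong
  -- the radicand at `j'` and the law algebra
  obtain ⟨hlocj, hsj, -, -, -⟩ := hrun.2 j'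
  obtain ⟨k, rfl⟩ : ∃ k, d = 2 * k + 1 := hd
  have hdiv : (2 * k + 1) / 2 = k := by omega
  rw [hdiv] at hlawEq
  have hum0 : u ^ k ≠ 0 := pow_ne_zero _ hu0
  have hsq : s j' ^ 2 =
      u * (W⁻¹ ^ 2 * ((F : R i) : K) / u ^ (2 * k + 1)) + (W⁻¹ * (((g : R i) : K) - G') / u ^ k) ^ 2 := by
    have h := sq_eq_of_law_odd_unit (g := ((g : R i) : K)) hu0 hW0 hlawEq
    have hFK : ((F : R i) : K) = s i ^ 2 - ((g : R i) : K) ^ 2 := by simp [hF]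
    rw [hFK, ← mul_div_assoc] at *
    exact h
  -- `h := W⁻¹ (g − G′)/u^k ∈ R j'`
  have hgR : W⁻¹ * (((g : R i) : K) - G') ∈ R j' := (R j').mul_mem hWi ((R j').sub_mem (hle g.2) hG'R)
  have humR : u ^ k ∈ R j' := (R j').pow_mem (hle huR) k
  have hG₁ : W⁻¹ ^ 2 * ((F : R i) : K) / u ^ (2 * k + 1) ∈ R j' := by
    have e : W⁻¹ ^ 2 * ((F : R i) : K) / u ^ (2 * k + 1) = W⁻¹ ^ 2 * (((F : R i) : K) / u ^ (2 * k + 1)) := by ring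
    rw [e]
    exact (R j').mul_mem ((R j').pow_mem hWi 2) hGmem
  have hhsq : (W⁻¹ * (((g : R i) : K) - G') / u ^ k) ^ 2 ∈ R j' := by
    have e : (W⁻¹ * (((g : R i) : K) - G') / u ^ k) ^ 2 =
        s j' ^ 2 - u * (W⁻¹ ^ 2 * ((F : R i) : K) / u ^ (2 * k + 1)) := by
      rw [hsq]; ring
    rw [e]
    exact (R j').sub_mem hsj ((R j').mul_mem (hle huR) hG₁)
  have hhR : W⁻¹ * (((g : R i) : K) - G') / u ^ k ∈ R j' := SwitchPlane.mem_of_sq_mem_transform hgR humR hum0 hhsq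
  -- the one-axis centre at `j'` with `c' := (W⁻¹)²`, `G := F/u^d`, `h := W⁻¹(g − G′)/u^k`
  have hf : (⟨s j' ^ 2, hsj⟩ : R j') =
      ⟨_, hhR⟩ ^ 2 + ⟨u, hle huR⟩ * (⟨W⁻¹, hWi⟩ ^ 2 * ⟨((F : R i) : K) / u ^ (2 * k + 1), hGmem⟩) := by
    apply Subtype.ext
    simp only [Subring.coe_mul, Subring.coe_add, SubmonoidClass.mk_pow]
    rw [hsq]; ring
  obtain ⟨Q, hQ⟩ := exists_isPermissibleCentre_oneAxis (hdom i) hbl' huR hum hu0 humax' hm𝔪 hm2 hmu (by omega) c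
    hFcong ⟨s j' ^ 2, hsj⟩ ⟨_, hhR⟩ (⟨W⁻¹, hWi⟩ ^ 2) ⟨_, hGmem⟩ rfl hf (h0 hsj) (h1 hsj) hn hdim
  -- σ_top maximality at `j'`
  exact SigmaTopMaximality.isPosStep_and_two_le_height_of_exists_isPermissibleCentre' hrun j'
    (fun _ _ => ⟨Q, hQ⟩) h0 h1

end Core

/-! ## §3 The one-axis slot (H3) from the pieces — the body of strat-2's `H3OneAxisTwoN` -/

section Slot

variable [CharP K 2] {O : ValuationSubring K} {R : ℕ → Subring K} {P : (i : ℕ) → Ideal (R i)} {t : K} {s : ℕ → K}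

/-- **(H3) ON ONE AXIS, FROM THE PIECES** (= `ArithReductionLegality.H3_of_pieces` with the second axis deleted; statement = the body of
res-L0-w41-strat-2's `NonRationalWindow.H3OneAxisTwoN`, words v3 9caa8decdca80901). In a steered run at `p = 2` (`R 0` dominated by `O`) whose
point steps recur, suppose: (S1a) at every late visit pair the member stays constant and the unit-cofactor strict-transform law holds, every member
is regular of dimension `n ≥ 3`, and beyond stage `N` the torsor at a point step has no singular prime of height `0` or `1` (N4). Then beyond `N`:
at a late A-STAGE `i` of odd cleaned order `d`, a UNIAXIAL on-axis datum `s i² − g² − c·m^d ∈ 𝔪^(d+1)` (`m ∈ 𝔪 ∖ 𝔪²`, `v m < v u`) forces a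
LATER positive step of height `≥ 2`. [cite: Matsumura1987, Thm. 14.2] [folklore] -/
theorem H3_oneAxis_of_pieces (hrun : IsSteeredRun O R P t 2 s) (hR0 : SubringDominates (R 0) O.toSubring)
    (hrec : ∀ i₀, ∃ i, i₀ ≤ i ∧ IsPointStep R P i) (N : ℕ)
    (hS1a : ∀ (j j' : ℕ) (x : K) (ν : ℕ), N ≤ j → IsVisitPair R P j j' →
      ((∃ hx : x ∈ R j, (⟨x, hx⟩ : R j) ∈ P j) ∧ x ≠ 0 ∧ ∀ y : R j, y ∈ P j → O.valuation (y : K) ≤ O.valuation x) →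
      HasCleanedOrderAt R s 2 j ν →
      R j' = R (j + 1) ∧ ∃ G W : K, G ∈ R j' ∧ W ∈ R j' ∧ W⁻¹ ∈ R j' ∧ W ≠ 0 ∧ s j' * x ^ (ν / 2) * W = s j - G)
    (hreg : ∀ i, IsRegularLocalRing (R i)) (n : ℕ) (hn : 3 ≤ n) (hdim : ∀ i, ringKrullDim (R i) = n)
    (h0 : ∀ j, N ≤ j → IsPointStep R P j → ∀ (hs' : s j ^ 2 ∈ R j) (Q : Ideal (R j)) [Q.IsPrime], Q.height = 0 →
      ¬ SigmaTopLegality.IsSingPrime (R j) 2 ⟨s j ^ 2, hs'⟩ Q)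
    (h1 : ∀ j, N ≤ j → IsPointStep R P j → ∀ (hs' : s j ^ 2 ∈ R j) (Q : Ideal (R j)) [Q.IsPrime], Q.height = 1 →
      ¬ SigmaTopLegality.IsSingPrime (R j) 2 ⟨s j ^ 2, hs'⟩ Q)
    (d : ℕ) (hd : Odd d) :
    ∀ (i : ℕ), N ≤ i → IsAStageAt R P s 2 i d →
      ∀ (_ : IsLocalRing (R i)) (hs : s i ^ 2 ∈ R i) (g m c : R i) (u : K),
        m ∈ maximalIdeal (R i) → m ∉ maximalIdeal (R i) ^ 2 →
        (⟨s i ^ 2, hs⟩ : R i) - g ^ 2 - c * m ^ d ∈ maximalIdeal (R i) ^ (d + 1) →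
        ((∃ hu : u ∈ R i, (⟨u, hu⟩ : R i) ∈ P i) ∧ u ≠ 0 ∧ ∀ y : R i, y ∈ P i → O.valuation (y : K) ≤ O.valuation u) →
        O.valuation (m : K) < O.valuation u →
        ∃ j', i < j' ∧ SigmaTopLegality.IsPosStep R P j' ∧ 2 ≤ (P j').height := by
  intro i hNi hA hloc hs g m c u hm𝔪 hm2 hcong hu hmu
  obtain ⟨hpt, -, -, hclean⟩ := hA
  obtain ⟨j', hvisit⟩ := exists_isVisitPair hrec hpt
  have hij : i < j' := hvisit.1
  haveI := hreg i
  haveI := hreg j'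
  obtain ⟨hRj, G', W, hG'R, -, hWi, hW0, hlawEq⟩ := hS1a i j' u d hNi hvisit hu hclean
  have h := exists_posStepTwo_oneAxis hrun hR0 hvisit hn (hdim j') hd hs g m c hm𝔪 hm2 hcong hu hmu hRj hG'R hWi hW0
    hlawEq (h0 j' (hNi.trans hij.le) hvisit.2.2.1) (h1 j' (hNi.trans hij.le) hvisit.2.2.1)
  exact ⟨j', hij, h⟩

end Slot

end ArithReductionLegality

end Summit.ResolutionOfSingularities.ResolutionOfSingularities.Theorems.SwitchingDichotomy

end
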